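import Summits.CriticalPhenomena.PercolationContinuityZ3.Theorems.PercNearOneGluingNoHeavyLowerTailSunflowerBlowup
import HarnessLib

/-!
# `NoHeavyLowerTail` (crux stmt-CriticalPhenomena-4575), abstract sunflower cubic: `TriangleFreeSafe` REDUCES TO TWIN-FREE MAXIMAL
# TRIANGLE-FREE GRAPHS

Support file (seat `prim-ineq-prove-1` gen 42; `--supports stmt-CriticalPhenomena-4575`).  No `sorry`, no named facts.  Memo:
run/shared/lean/prim/prim-ineq-prove-1/FINDING-BLOWUP-prove1-g42.md §2b.

By `…SunflowerBlowup` A-safety of a graph core is invariant under blow-up and pulls back along induced subgraphs (`aSafe_edgeCore_comap`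
with `f` injective), and the typed conjecture `TriangleFreeSafe` (g39) is equivalent to its restriction to twin-free graphs.  Here:
* `exists_saturated_extension` — **every finite triangle-free graph is an induced subgraph of a finite MAXIMAL triangle-free graph**
  (`K3Saturated`: any two distinct non-adjacent vertices have a common neighbour).  Greedy proof: while some BAD pair (distinct,
  non-adjacent, no common neighbour) exists, extend it to a maximal independent set `M` (`exists_maximal_indep`) and add a new
  vertex joined exactly to `M` (`coneGraph`; still triangle-free, `cliqueFree_three_coneGraph`); the old bad pair gets a common
  neighbour and the new vertex lies in no bad pair (a vertex outside `M` has a neighbour in `M`), so `badCount` drops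
  (`badCount_coneGraph_lt`).
* `k3Saturated_twinQuotient` — the twin quotient of a maximal triangle-free graph is maximal triangle-free.
* **`triangleFreeSafe_iff_saturated_twinFree`** — `TriangleFreeSafe ↔` every TWIN-FREE MAXIMAL triangle-free graph has an A-safe
  graph core.  The census of such graphs (memo §2c; exact generation of all triangle-free graphs up to isomorphism): `K₂` (2 vertices),
  `C₅` (5; kernel `Pentagon.safe_core`), the Möbius ladder `M₈` (8; census), exactly ONE graph on 9 vertices (first case outside the
  `≤ 8`-vertex census; numerically safe, memo §4), … — so the conjecture is now a statement about a short explicit list per order.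
-/

noncomputable section

namespace Summit.CriticalPhenomena.PercolationContinuityZ3.Theorems.SunflowerPartition

namespace SafeCalc

open Finset


/-! ## The conjecture reduces to twin-free MAXIMAL triangle-free graphs -/

section Saturated

universe u

variable {V : Type*}

/-- `Γ` is **`K₃`-saturated in the two-step sense**: any two distinct non-adjacent vertices have a common neighbour (for a
triangle-free graph this says exactly that adding any further edge creates a triangle, i.e. `Γ` is a MAXIMAL triangle-free graph;
equivalently `Γ` has diameter `≤ 2`). [this work] -/
def K3Saturated (Γ : SimpleGraph V) : Prop := ∀ u v, u ≠ v → ¬ Γ.Adj u v → ∃ w, Γ.Adj u w ∧ Γ.Adj v w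

/-- A **bad pair**: distinct, non-adjacent, without a common neighbour. [this work] -/
def BadPair (Γ : SimpleGraph V) (u v : V) : Prop := u ≠ v ∧ ¬ Γ.Adj u v ∧ ∀ w, ¬ (Γ.Adj u w ∧ Γ.Adj v w)

open Classical in
/-- The number of (ordered) bad pairs. [this work] -/
def badCount [Fintype V] (Γ : SimpleGraph V) : ℕ := (univ.filter fun q : V × V => BadPair Γ q.1 q.2).card

/-- No bad pairs means saturated. [this work] -/
theorem k3Saturated_of_badCount_eq_zero [Fintype V] (Γ : SimpleGraph V) (h : badCount Γ = 0) : K3Saturated Γ := by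
  classical
  intro u v huv hadj
  by_contra hno
  have hmem : (u, v) ∈ univ.filter fun q : V × V => BadPair Γ q.1 q.2 :=
    mem_filter.2 ⟨mem_univ _, huv, hadj, fun w hw => hno ⟨w, hw.1, hw.2⟩⟩
  rw [badCount, Finset.card_eq_zero] at h
  rw [h] at hmem
  exact Finset.notMem_empty _ hmem

/-- The **cone** over an independent set `M`: a new vertex `none` adjacent exactly to `M`. [this work] -/
def coneGraph (Γ : SimpleGraph V) (M : Finset V) : SimpleGraph (Option V) where
  Adj x y := match x, y with
    | some a, some b => Γ.Adj a b
    | none, some b => b ∈ M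
    | some a, none => a ∈ M
    | none, none => False
  symm := ⟨fun x y h => by
    cases x <;> cases y
    · exact h
    · exact h
    · exact h
    · exact Γ.adj_symm h⟩
  loopless := ⟨fun x h => by
    cases x
    · exact h
    · exact Γ.irrefl h⟩

/-- The old graph is the induced subgraph of the cone on the old vertices. [this work] -/
theorem coneGraph_comap_some (Γ : SimpleGraph V) (M : Finset V) : (coneGraph Γ M).comap some = Γ := by
  ext u v
  rfl

/-- The cone over an INDEPENDENT set of a triangle-free graph is triangle-free. [this work] -/
theorem cliqueFree_three_coneGraph [DecidableEq V] (Γ : SimpleGraph V) (hΓ : Γ.CliqueFree 3) (M : Finset V)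
    (hM : ∀ a ∈ M, ∀ b ∈ M, ¬ Γ.Adj a b) : (coneGraph Γ M).CliqueFree 3 := by
  classical
  intro t ht
  rw [SimpleGraph.is3Clique_iff] at ht
  obtain ⟨x, y, z, hxy, hxz, hyz, -⟩ := ht
  cases x with
  | none =>
    cases y with
    | none => exact hxy
    | some b =>
      cases z with
      | none => exact hxz
      | some c => exact hM b hxy c hxz hyz
  | some a =>
    cases y with
    | none =>
      cases z with
      | none => exact hyz
      | some c => exact hM a hxy c hyz hxz
    | some b =>
      cases z with
      | none => exact hM a hxz b hyz hxy
      | some c => exact hΓ {a, b, c} (SimpleGraph.is3Clique_triple_iff.2 ⟨hxy, hxz, hyz⟩)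

/-- Every independent set of a finite graph extends to a MAXIMAL independent set (every outside vertex has a neighbour inside).
[folklore; this work] -/
theorem exists_maximal_indep [Fintype V] [DecidableEq V] (Γ : SimpleGraph V) [DecidableRel Γ.Adj] (S : Finset V)
    (hS : ∀ a ∈ S, ∀ b ∈ S, ¬ Γ.Adj a b) :
    ∃ M : Finset V, S ⊆ M ∧ (∀ a ∈ M, ∀ b ∈ M, ¬ Γ.Adj a b) ∧ ∀ a ∉ M, ∃ b ∈ M, Γ.Adj a b := by
  classical
  let P : Finset V → Prop := fun T => S ⊆ T ∧ ∀ a ∈ T, ∀ b ∈ T, ¬ Γ.Adj a b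
  obtain ⟨M, hMP, hmax⟩ := (univ.filter P).exists_max_image Finset.card ⟨S, mem_filter.2 ⟨mem_univ _, subset_rfl, hS⟩⟩
  obtain ⟨hSM, hMind⟩ := (mem_filter.1 hMP).2
  refine ⟨M, hSM, hMind, fun a haM => ?_⟩
  by_contra hno
  have hno' : ∀ b ∈ M, ¬ Γ.Adj a b := fun b hb hab => hno ⟨b, hb, hab⟩
  have hP : P (insert a M) := by
    refine ⟨hSM.trans (Finset.subset_insert _ _), fun x hx y hy => ?_⟩
    rcases Finset.mem_insert.1 hx with rfl | hx'
    · rcases Finset.mem_insert.1 hy with rfl | hy'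
      · exact Γ.irrefl
      · exact hno' y hy'
    · rcases Finset.mem_insert.1 hy with rfl | hy'
      · exact fun h => hno' x hx' (Γ.adj_symm h)
      · exact hMind x hx' y hy'
  have := hmax (insert a M) (mem_filter.2 ⟨mem_univ _, hP⟩)
  rw [Finset.card_insert_of_notMem haM] at this
  omega

/-- Coning over a maximal independent set through a bad pair kills that bad pair and creates none. [this work] -/
theorem badCount_coneGraph_lt [Fintype V] [DecidableEq V] (Γ : SimpleGraph V) (M : Finset V)
    (hMmax : ∀ a ∉ M, ∃ b ∈ M, Γ.Adj a b) {u₀ v₀ : V} (hu₀ : u₀ ∈ M) (hv₀ : v₀ ∈ M) (hbad : BadPair Γ u₀ v₀) :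
    badCount (coneGraph Γ M) < badCount Γ := by
  classical
  unfold badCount
  -- every bad pair of the cone comes from a bad pair of `Γ` other than `(u₀, v₀)`
  have hsub : (univ.filter fun q : Option V × Option V => BadPair (coneGraph Γ M) q.1 q.2) ⊆
      ((univ.filter fun q : V × V => BadPair Γ q.1 q.2).erase (u₀, v₀)).map
        ((Function.Embedding.some).prodMap Function.Embedding.some) := by
    intro q hq
    obtain ⟨hne, hadj, hno⟩ := (mem_filter.1 hq).2
    obtain ⟨x, y⟩ := q
    -- neither coordinate is the cone point
    have key : ∀ a : V, ¬ BadPair (coneGraph Γ M) none (some a) := by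
      rintro a ⟨-, hadj', hno'⟩
      by_cases ha : a ∈ M
      · exact hadj' ha
      · obtain ⟨b, hb, hab⟩ := hMmax a ha
        exact hno' (some b) ⟨hb, hab⟩
    cases x with
    | none =>
      cases y with
      | none => exact (hne rfl).elim
      | some b => exact (key b ⟨hne, hadj, hno⟩).elim
    | some a =>
      cases y with
      | none =>
        refine (key a ⟨Ne.symm hne, fun h => hadj ((coneGraph Γ M).adj_symm h), fun w hw => hno w ⟨hw.2, hw.1⟩⟩).elim
      | some b =>
        rw [Finset.mem_map]
        refine ⟨(a, b), Finset.mem_erase.2 ⟨?_, mem_filter.2 ⟨mem_univ _, fun h => hne (congrArg some h), hadj,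
          fun w hw => hno (some w) hw⟩⟩, rfl⟩
        rintro ⟨rfl, rfl⟩
        exact hno none ⟨hu₀, hv₀⟩
  have hmem : (u₀, v₀) ∈ univ.filter fun q : V × V => BadPair Γ q.1 q.2 := mem_filter.2 ⟨mem_univ _, hbad⟩
  calc (univ.filter fun q : Option V × Option V => BadPair (coneGraph Γ M) q.1 q.2).card
      ≤ (((univ.filter fun q : V × V => BadPair Γ q.1 q.2).erase (u₀, v₀)).map
          ((Function.Embedding.some).prodMap Function.Embedding.some)).card := Finset.card_le_card hsub
    _ = (univ.filter fun q : V × V => BadPair Γ q.1 q.2).card - 1 := by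
        rw [Finset.card_map, Finset.card_erase_of_mem hmem]
    _ < (univ.filter fun q : V × V => BadPair Γ q.1 q.2).card := by
        have : 0 < (univ.filter fun q : V × V => BadPair Γ q.1 q.2).card := Finset.card_pos.2 ⟨_, hmem⟩
        omega

/-- **Every finite triangle-free graph is an induced subgraph of a finite MAXIMAL triangle-free graph** (greedy: cone over a maximal
independent set through a bad pair; the number of bad pairs drops). [folklore; this work] -/
theorem exists_saturated_extension : ∀ (k : ℕ) {V : Type u} [Fintype V] [DecidableEq V] (Γ : SimpleGraph V),
    Γ.CliqueFree 3 → badCount Γ ≤ k →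
    ∃ (W : Type u) (_ : Fintype W) (_ : DecidableEq W) (Γ' : SimpleGraph W) (f : V → W),
      Function.Injective f ∧ Γ'.CliqueFree 3 ∧ K3Saturated Γ' ∧ Γ'.comap f = Γ := by
  intro k
  induction k with
  | zero =>
    intro V _ _ Γ hΓ hk
    exact ⟨V, inferInstance, inferInstance, Γ, id, Function.injective_id, hΓ,
      k3Saturated_of_badCount_eq_zero Γ (Nat.le_zero.1 hk), SimpleGraph.comap_id⟩
  | succ k ih =>
    intro V _ _ Γ hΓ hk
    classical
    by_cases h0 : badCount Γ = 0
    · exact ⟨V, inferInstance, inferInstance, Γ, id, Function.injective_id, hΓ,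
        k3Saturated_of_badCount_eq_zero Γ h0, SimpleGraph.comap_id⟩
    · obtain ⟨⟨u₀, v₀⟩, hq⟩ := Finset.card_pos.1 (Nat.pos_of_ne_zero h0)
      have hbad : BadPair Γ u₀ v₀ := (mem_filter.1 hq).2
      obtain ⟨M, hSM, hMind, hMmax⟩ := exists_maximal_indep Γ {u₀, v₀} (by
        intro a ha b hb
        simp only [Finset.mem_insert, Finset.mem_singleton] at ha hb
        rcases ha with rfl | rfl <;> rcases hb with rfl | rfl
        · exact Γ.irrefl
        · exact hbad.2.1
        · exact fun h => hbad.2.1 (Γ.adj_symm h)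
        · exact Γ.irrefl)
      have hu₀ : u₀ ∈ M := hSM (Finset.mem_insert_self _ _)
      have hv₀ : v₀ ∈ M := hSM (Finset.mem_insert_of_mem (Finset.mem_singleton_self _))
      have hlt := badCount_coneGraph_lt Γ M hMmax hu₀ hv₀ hbad
      obtain ⟨W, _, _, Γ', g, hg, hΓ'3, hsat, hcomap⟩ :=
        ih (coneGraph Γ M) (cliqueFree_three_coneGraph Γ hΓ M hMind) (by omega)
      refine ⟨W, inferInstance, inferInstance, Γ', g ∘ some, hg.comp (Option.some_injective V), hΓ'3, hsat, ?_⟩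
      rw [← SimpleGraph.comap_comap, hcomap, coneGraph_comap_some]

/-- The twin quotient of a saturated graph is saturated. [this work] -/
theorem k3Saturated_twinQuotient (Γ : SimpleGraph V) (h : K3Saturated Γ) : K3Saturated (twinQuotient Γ) := by
  intro a b
  refine Quotient.inductionOn₂ a b fun u v hne hadj => ?_
  have huv : u ≠ v := fun h' => hne (by rw [h'])
  obtain ⟨w, huw, hvw⟩ := h u v huv hadj
  exact ⟨Quotient.mk _ w, huw, hvw⟩

end Saturated

/-- **`TriangleFreeSafe` IS EQUIVALENT TO ITS RESTRICTION TO TWIN-FREE MAXIMAL TRIANGLE-FREE GRAPHS** (every two distinct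
non-adjacent vertices have a common neighbour): embed a triangle-free graph as an induced subgraph of a maximal one
(`exists_saturated_extension`), pass to the twin quotient (still maximal, triangle-free, and twin-free), and pull safety back along
the composite map (`aSafe_edgeCore_comap`). [this work] -/
theorem triangleFreeSafe_iff_saturated_twinFree :
    TriangleFreeSafe ↔ ∀ (n : ℕ) (Γ : SimpleGraph (Fin n)), Γ.CliqueFree 3 → K3Saturated Γ → TwinFree Γ →
      ∀ p : Fin n → unitInterval, Safe p (edgeCore Γ) := by
  refine ⟨fun h n Γ h3 _ _ p => h n Γ h3 p, fun h n Γ h3 p => ?_⟩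
  classical
  obtain ⟨W, _, _, Γ', f, -, hΓ'3, hsat, hcomap⟩ := exists_saturated_extension (badCount Γ) Γ h3 le_rfl
  -- twin quotient of the saturated extension, transported to `Fin m`
  let e : Quotient (twinSetoid Γ') ≃ Fin (Fintype.card (Quotient (twinSetoid Γ'))) := Fintype.equivFin _
  let Δ : SimpleGraph (Fin (Fintype.card (Quotient (twinSetoid Γ')))) := (twinQuotient Γ').comap e.symm
  have hΓ : Δ.comap (e ∘ Quotient.mk (twinSetoid Γ') ∘ f) = Γ := by
    rw [← hcomap]
    ext u v
    simp only [Δ, SimpleGraph.comap_adj, Function.comp_apply, Equiv.symm_apply_apply]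
    rfl
  have hΔ3 : Δ.CliqueFree 3 :=
    SimpleGraph.CliqueFree.comap (SimpleGraph.Embedding.comap e.symm.toEmbedding (twinQuotient Γ')).isContained
      (cliqueFree_three_twinQuotient Γ' hΓ'3)
  have hΔtf : TwinFree Δ := by
    intro a b hab
    apply e.symm.injective
    refine twinFree_twinQuotient Γ' _ _ fun w => ?_
    have hw := hab (e w)
    simp only [Δ, SimpleGraph.comap_adj, Equiv.symm_apply_apply] at hw
    exact hw
  have hΔsat : K3Saturated Δ := by
    intro a b hne hadj
    have hne' : e.symm a ≠ e.symm b := fun h' => hne (e.symm.injective h')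
    obtain ⟨w, haw, hbw⟩ := k3Saturated_twinQuotient Γ' hsat (e.symm a) (e.symm b) hne' hadj
    refine ⟨e w, ?_, ?_⟩
    · simp only [Δ, SimpleGraph.comap_adj, Equiv.symm_apply_apply]; exact haw
    · simp only [Δ, SimpleGraph.comap_adj, Equiv.symm_apply_apply]; exact hbw
  rw [← hΓ]
  exact aSafe_edgeCore_comap _ Δ (h _ Δ hΔ3 hΔsat hΔtf) p

end SafeCalc

end Summit.CriticalPhenomena.PercolationContinuityZ3.Theorems.SunflowerPartition
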